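import Summits.ValiantsHypothesis.ValiantsHypothesis.Theorems.BarrierLeverSuccinctHittingSetsForVPStubReadOnceGeneratorLemmas

/-!
# Crux `BarrierLever.SuccinctHittingSetsForVP` (stmt-ValiantsHypothesis-14610), line `registered`
(birth), wave 10 — stub `stub_readOnceGenerator`: the Shpilka–Volkovich generator with `t` seeded
copies of a Lagrange family hits every nonzero preprocessed read-once polynomial on `< 2^t` variables

Registered stub of line `birth` (LEDGER registry, wave 10 of 2026-08-17, lead c5, skeleton sha
`c792cfbe…`; the statement's text is NOT in the tree's `Cruxes/SuccinctHittingSetsForVP/Lines/birth.lean`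
v20, which only announces wave 10 — the registered signature is reproduced verbatim below). The abstract induction is the
LANDED lemmas file `…StubReadOnceGeneratorLemmas.lean` (`ReadOnceGenerator.core` = Shpilka–Volkovich
2015 Thm. 1 for any seeded family `G_J : ι → ℂ[V]` with an AXIS map `hσ`, a KILL map `hτ` and a
FRESH-SEED map `hρ`). This file supplies the concrete family of the registered statement and the
three maps, nothing more:

* variables `V = Fin t ⊕ (Fin t × Z)`: seeds `λ_j = X (inl j)` and `t` disjoint copies `Z^{(j)}` of the
  variables of the Lagrange family `L : ι → ℂ[Z]` (`L_μ(pt_ν) = δ_{μν}`);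
* `G_J μ = C (y μ) + Σ_{j ∈ J} λ_j · L_μ(Z^{(j)})` (`J ⊆ Fin t` the active seeds; at `J = univ` this is
  the map of the registered statement);
* AXIS (`hσ`): substitute the point `pt_{μ₀}` for the `j₀`-th copy of `Z` — `L_ν(pt_{μ₀}) = δ_{ν μ₀}`
  turns the `j₀`-th summand into `[ν = μ₀] · λ_{j₀}`; KILL (`hτ`): `λ_{j₀} ↦ 0`; FRESH SEED (`hρ`,
  `j₀ ∉ J`): `λ_{j₀} ↦ X`, every other variable `↦ 0`, landing in `ℂ[X]` with `G_J ν ↦ y_ν`.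

Then `ReadOnceGenerator.core` at `J = univ` (`|S| ≤ |ι| < 2^t`): a nonzero PROP `D` is a nonzero
constant (image `C a ≠ 0`) or has non-constant image — either way `D ∘ G ≠ 0`.

Honest framing: this carves the (preprocessed) read-once distinguishers out of level one of
Forbes–Shpilka–Volk's Question 6 (evidence of FSV18 Thm-9 type: read-once polynomials are never
algebraically natural proofs against the generator's small circuits); the heart `stub_heart` ≡ the
crux and FSV Question 6 remain OPEN; nothing here bears on `VP ≠ VNP`.

References: [ShpilkaVolkovich2015] A. Shpilka, I. Volkovich, *Read-once polynomial identity
testing*, Comput. Complexity 24 (2015) 477–532, Thm. 1, §5 (the generator `G_{n,t}`);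
[MinahanVolkovich2017] D. Minahan, I. Volkovich, CCC 2017 (LIPIcs 79) 32, Def. 12;
[ForbesShpilkaVolk2018] M. Forbes, A. Shpilka, B. L. Volk, Theory Comput. 14 (2018), Question 6.
-/

-- layout Summits/ValiantsHypothesis/ValiantsHypothesis forces the duplicated namespace component
set_option linter.dupNamespace false

noncomputable section

namespace Summit.ValiantsHypothesis.ValiantsHypothesis.Theorems.BarrierLever.SuccinctHittingSetsForVP

open Literature.Barriers.ValiantsHypothesis Literature.Computability.AlgebraicComplexity MvPolynomial

namespace ReadOnceGenerator

/-- Substituting constants: `aeval (C ∘ a) p = C (eval a p)`. [folklore] -/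
private theorem aeval_C_comp {Z W : Type} (a : Z → ℂ) (p : MvPolynomial Z ℂ) :
    aeval (fun z => (C (a z) : MvPolynomial W ℂ)) p = C (eval a p) := by
  induction p using MvPolynomial.induction_on with
  | C c => simp only [aeval_C, algebraMap_eq, eval_C]
  | add p q hp hq => simp only [map_add, hp, hq]
  | mul_X p z hp => simp only [map_mul, hp, aeval_X, eval_X]

/-- Renaming is evaluation at renamed variables: `aeval (X ∘ g) p = rename g p`. [folklore] -/
private theorem aeval_X_comp {Z W : Type} (g : Z → W) (p : MvPolynomial Z ℂ) :
    aeval (fun z => (X (g z) : MvPolynomial W ℂ)) p = rename g p := by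
  induction p using MvPolynomial.induction_on with
  | C c => simp only [aeval_C, algebraMap_eq, rename_C]
  | add p q hp hq => simp only [map_add, hp, hq]
  | mul_X p z hp => simp only [map_mul, hp, aeval_X, rename_X]

variable {ι : Type} [DecidableEq ι] {Z : Type} {t : ℕ}

/-- **AXIS map.** Substituting the interpolation point `pt_{μ₀}` for the `j₀`-th copy of the
`Z`-variables sends `G_J ν` to `G_{J ∖ j₀} ν + [ν = μ₀] · λ_{j₀}` (`L_ν(pt_{μ₀}) = δ_{ν μ₀}`).
[cite: ShpilkaVolkovich2015, Thm. 1] -/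
theorem axis (L : ι → MvPolynomial Z ℂ) (pt : ι → Z → ℂ)
    (hL : ∀ μ ν : ι, MvPolynomial.eval (pt ν) (L μ) = if μ = ν then 1 else 0) (y : ι → ℂ)
    (J : Finset (Fin t)) (j₀ : Fin t) (hj₀ : j₀ ∈ J) (μ₀ : ι) :
    ∃ σ : MvPolynomial (Fin t ⊕ (Fin t × Z)) ℂ →ₐ[ℂ] MvPolynomial (Fin t ⊕ (Fin t × Z)) ℂ,
      ∀ ν, σ (C (y ν) + ∑ j ∈ J, X (Sum.inl j) * rename (fun z => Sum.inr (j, z)) (L ν)) =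
        (C (y ν) + ∑ j ∈ J.erase j₀, X (Sum.inl j) * rename (fun z => Sum.inr (j, z)) (L ν)) +
          if ν = μ₀ then X (Sum.inl j₀) else 0 := by
  refine ⟨aeval (Sum.elim (fun j => X (Sum.inl j))
    (fun p : Fin t × Z => if p.1 = j₀ then C (pt μ₀ p.2) else X (Sum.inr p))), fun ν => ?_⟩
  have hcopy : ∀ j : Fin t, aeval (Sum.elim (fun j => (X (Sum.inl j) : MvPolynomial (Fin t ⊕ (Fin t × Z)) ℂ))
      (fun p : Fin t × Z => if p.1 = j₀ then C (pt μ₀ p.2) else X (Sum.inr p)))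
        (rename (fun z => Sum.inr (j, z)) (L ν)) =
      if j = j₀ then C (if ν = μ₀ then (1 : ℂ) else 0)
      else rename (fun z => Sum.inr (j, z)) (L ν) := by
    intro j
    rw [aeval_rename]
    by_cases hj : j = j₀
    · have hf : ((Sum.elim (fun j => (X (Sum.inl j) : MvPolynomial (Fin t ⊕ (Fin t × Z)) ℂ))
          (fun p : Fin t × Z => if p.1 = j₀ then C (pt μ₀ p.2) else X (Sum.inr p))) ∘
            fun z => Sum.inr (j, z)) = fun z => C (pt μ₀ z) := by
        funext z
        simp [hj]
      rw [if_pos hj, hf, aeval_C_comp, hL ν μ₀]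
    · have hf : ((Sum.elim (fun j => (X (Sum.inl j) : MvPolynomial (Fin t ⊕ (Fin t × Z)) ℂ))
          (fun p : Fin t × Z => if p.1 = j₀ then C (pt μ₀ p.2) else X (Sum.inr p))) ∘
            fun z => Sum.inr (j, z)) = fun z => X (Sum.inr (j, z)) := by
        funext z
        simp [hj]
      rw [if_neg hj, hf, aeval_X_comp]
  rw [← Finset.add_sum_erase J (fun j => (X (Sum.inl j) : MvPolynomial (Fin t ⊕ (Fin t × Z)) ℂ) *
    rename (fun z => Sum.inr (j, z)) (L ν)) hj₀]
  rw [map_add, map_add, map_sum]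
  simp only [map_mul, aeval_X, Sum.elim_inl, aeval_C, algebraMap_eq, hcopy, if_true]
  have hrest : ∑ j ∈ J.erase j₀, (X (Sum.inl j) : MvPolynomial (Fin t ⊕ (Fin t × Z)) ℂ) *
      (if j = j₀ then C (if ν = μ₀ then (1 : ℂ) else 0)
        else rename (fun z => Sum.inr (j, z)) (L ν)) =
      ∑ j ∈ J.erase j₀, X (Sum.inl j) * rename (fun z => Sum.inr (j, z)) (L ν) := by
    refine Finset.sum_congr rfl fun j hj => ?_
    rw [if_neg (Finset.ne_of_mem_erase hj)]
  rw [hrest]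
  by_cases hν : ν = μ₀
  · rw [if_pos hν, if_pos hν, map_one, mul_one]
    ring
  · rw [if_neg hν, if_neg hν, map_zero, mul_zero]
    ring

omit [DecidableEq ι] in
/-- **KILL map.** `λ_{j₀} ↦ 0` sends `G_J ν` to `G_{J ∖ j₀} ν`. [cite: ShpilkaVolkovich2015, Thm. 1] -/
theorem kill (L : ι → MvPolynomial Z ℂ) (y : ι → ℂ) (J : Finset (Fin t)) (j₀ : Fin t)
    (hj₀ : j₀ ∈ J) :
    ∃ τ : MvPolynomial (Fin t ⊕ (Fin t × Z)) ℂ →ₐ[ℂ] MvPolynomial (Fin t ⊕ (Fin t × Z)) ℂ,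
      ∀ ν, τ (C (y ν) + ∑ j ∈ J, X (Sum.inl j) * rename (fun z => Sum.inr (j, z)) (L ν)) =
        C (y ν) + ∑ j ∈ J.erase j₀, X (Sum.inl j) * rename (fun z => Sum.inr (j, z)) (L ν) := by
  refine ⟨aeval (Sum.elim (fun j => if j = j₀ then 0 else X (Sum.inl j))
    (fun p : Fin t × Z => X (Sum.inr p))), fun ν => ?_⟩
  have hcopy : ∀ j : Fin t, aeval (Sum.elim (fun j => if j = j₀ then (0 : MvPolynomial (Fin t ⊕ (Fin t × Z)) ℂ) else X (Sum.inl j))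
      (fun p : Fin t × Z => X (Sum.inr p))) (rename (fun z => Sum.inr (j, z)) (L ν)) =
      rename (fun z => Sum.inr (j, z)) (L ν) := by
    intro j
    rw [aeval_rename, ← aeval_X_comp (g := fun z => (Sum.inr (j, z) : Fin t ⊕ (Fin t × Z)))]
    congr 1
  rw [← Finset.add_sum_erase J (fun j => (X (Sum.inl j) : MvPolynomial (Fin t ⊕ (Fin t × Z)) ℂ) *
    rename (fun z => Sum.inr (j, z)) (L ν)) hj₀]
  rw [map_add, map_add, map_sum]
  simp only [map_mul, aeval_X, Sum.elim_inl, aeval_C, algebraMap_eq, hcopy, if_true, zero_mul,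
    zero_add]
  congr 1
  refine Finset.sum_congr rfl fun j hj => ?_
  rw [if_neg (Finset.ne_of_mem_erase hj)]

omit [DecidableEq ι] in
/-- **FRESH-SEED map.** For `j₀ ∉ J`: `λ_{j₀} ↦ X`, every other variable `↦ 0`, lands in `ℂ[X]` with
`G_J ν ↦ y_ν`. [cite: ShpilkaVolkovich2015, Thm. 1] -/
theorem fresh (L : ι → MvPolynomial Z ℂ) (y : ι → ℂ) (J : Finset (Fin t)) (j₀ : Fin t)
    (hj₀ : j₀ ∉ J) :
    ∃ ρ : MvPolynomial (Fin t ⊕ (Fin t × Z)) ℂ →ₐ[ℂ] Polynomial ℂ,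
      (∀ ν, ρ (C (y ν) + ∑ j ∈ J, X (Sum.inl j) * rename (fun z => Sum.inr (j, z)) (L ν)) =
        Polynomial.C (y ν)) ∧ ρ (X (Sum.inl j₀)) = Polynomial.X := by
  refine ⟨aeval (Sum.elim (fun j => if j = j₀ then Polynomial.X else 0) (fun _ : Fin t × Z => 0)),
    fun ν => ?_, by simp⟩
  rw [map_add, map_sum, aeval_C, Polynomial.algebraMap_eq]
  rw [Finset.sum_eq_zero fun j hj => ?_]
  · rw [add_zero]
  · have hne : j ≠ j₀ := fun h => hj₀ (h ▸ hj)
    rw [map_mul, aeval_X, Sum.elim_inl, if_neg hne, zero_mul]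

end ReadOnceGenerator

/-- **Registered stub `stub_readOnceGenerator`** (crux stmt-ValiantsHypothesis-14610, line `birth`;
ledger registry wave 10 of 2026-08-17, skeleton sha `c792cfbe…`, text not in `birth.lean` v20;
signature verbatim): for a Lagrange family `L : ι → ℂ[Z]` with points `pt`
(`L_μ(pt_ν) = δ_{μν}`) and `|ι| < 2^t`, the Shpilka–Volkovich map
`μ ↦ y_μ + Σ_{j<t} λ_j · L_μ(Z^{(j)})` (seeds `λ_j`, `t` disjoint copies of `Z`) annihilates no nonzero
preprocessed read-once polynomial `D` (`IsPROP S D`). From `ReadOnceGenerator.core` (the landed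
abstract induction) with the AXIS / KILL / FRESH-SEED maps `ReadOnceGenerator.axis/kill/fresh`.
[cite: ShpilkaVolkovich2015, Thm. 1] -/
theorem stub_readOnceGenerator :
    ∀ (ι : Type) [Fintype ι] [DecidableEq ι] (Z : Type) (t : ℕ) (L : ι → MvPolynomial Z ℂ)
      (pt : ι → Z → ℂ), (∀ μ ν : ι, MvPolynomial.eval (pt ν) (L μ) = if μ = ν then 1 else 0) →
      Fintype.card ι < 2 ^ t →
      ∀ (y : ι → ℂ) (D : MvPolynomial ι ℂ) (S : Finset ι), IsPROP S D → D ≠ 0 →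
        MvPolynomial.aeval (fun μ : ι => (C (y μ) : MvPolynomial (Fin t ⊕ (Fin t × Z)) ℂ) +
          ∑ j : Fin t, X (Sum.inl j) * rename (fun z => Sum.inr (j, z)) (L μ)) D ≠ 0 := by
  intro ι _ _ Z t L pt hL ht y D S hD hD0
  have hcore := ReadOnceGenerator.core (ι := ι) (K := Fin t) (V := Fin t ⊕ (Fin t × Z)) (y := y)
    (G := fun J μ => C (y μ) + ∑ j ∈ J, X (Sum.inl j) * rename (fun z => Sum.inr (j, z)) (L μ))
    (lam := fun j => X (Sum.inl j))
    (fun J j₀ hj₀ μ₀ => ReadOnceGenerator.axis L pt hL y J j₀ hj₀ μ₀)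
    (fun J j₀ hj₀ => ReadOnceGenerator.kill L y J j₀ hj₀)
    (fun J j₀ hj₀ => ReadOnceGenerator.fresh L y J j₀ hj₀) hD Finset.univ
    (by
      rw [Finset.card_univ, Fintype.card_fin]
      exact (Finset.card_le_univ S).trans_lt ht)
  rcases hcore with ⟨a, rfl⟩ | hdeg
  · have ha : a ≠ 0 := fun h => hD0 (by rw [h, C_0])
    rw [aeval_C, algebraMap_eq]
    exact (C_eq_zero.not).mpr ha
  · intro h0
    rw [h0, totalDegree_zero] at hdeg
    exact hdeg rfl

end Summit.ValiantsHypothesis.ValiantsHypothesis.Theorems.BarrierLever.SuccinctHittingSetsForVP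

end
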